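import Literature.Computability.AlgebraicComplexity.SubgroupTPPQuotient
import Mathlib.Tactic.Ring
import HarnessLib

/-!
# Hedtke 2011: the normal-core bound `|S||T||U| ≤ |S| · |G| / |Core_G(S)|` for subgroup TPP triples

Topic `Literature/Computability/AlgebraicComplexity`; a corollary file of `SubgroupTPPQuotient.lean`
(`Murthy2026_prop26_2_subgroup`: a NORMAL member of a subgroup TPP triple forces `|S||T||U| ≤ |G|` —
Hedtke's "Fact 3 (Hedtke–Murthy 2011)").

I. Hedtke, *A note on the Triple Product Property subgroup capacity of finite groups*, arXiv:1107.5969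
(2011), §1 and §2 (held text pp. 3–4), verbatim:

> **Fact 3** (HedtkeMurthy2011). If `(S,T,U)` is a TPP triple of subgroups of `G` and one of `S`, `T` or
> `U` is normal in `G`, then `|S|·|T|·|U| ≤ |G|`.
> […] Assume that `(Sᵢ,Sⱼ,Sₖ)` is a TPP triple of subgroups of `G`. For every subset `A ⊆ Sᵢ` of `Sᵢ`,
> `(A,Sⱼ,Sₖ)` is a TPP triple, too. If `Sᵢ` contains a normal subgroup `N ⊲ G` of `G`, then `(N,Sⱼ,Sₖ)`
> is a TPP triple of `G` which fulfills the Fact 3. It follows that `|Sⱼ|·|Sₖ| ≤ |G|/|N|`. Obviously,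
> this holds for the biggest normal subgroup in `Sᵢ`, too:
> `|Sᵢ|·|Sⱼ|·|Sₖ| ≤ |Sᵢ| · |G| / |Core_G(Sᵢ)|`.

(This is the "normal-core bound" quoted in `NormalizerBarrier.lean`, evasions (vi).)

## What is here (all proved; 0 definitions, 0 named facts)
* `DihedralSubgroups.SubgroupTPP.mono₁` — shrinking the first member keeps the subgroup TPP;
* `Hedtke2011_coreBound` — `|Core_G(S)| · |T| · |U| ≤ |G|`;
* `Hedtke2011_coreBound'` — the printed form `|S||T||U| · |Core_G(S)| ≤ |S| · |G|`.

## References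
* [Hedtke2011] arXiv:1107.5969, Fact 3 and §2 (proof of the Theorem).
* [Murthy2026] Prop. 2.6 (2) (the tree's `Murthy2026_prop26_2_subgroup`).
-/

namespace Literature.Computability.AlgebraicComplexity

open DihedralSubgroups

variable {G : Type*} [Group G]

/-- Shrinking the first member of a subgroup TPP triple keeps the TPP ("For every subset `A ⊆ Sᵢ`,
`(A,Sⱼ,Sₖ)` is a TPP triple, too"). [cite: Hedtke2011, §2 (proof of the Theorem)] -/
theorem DihedralSubgroups.SubgroupTPP.mono₁ {S S' T U : Subgroup G} (h : SubgroupTPP S T U)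
    (hS : S' ≤ S) : SubgroupTPP S' T U :=
  fun a ha b hb c hc habc => h a (hS ha) b hb c hc habc

/-- **Hedtke 2011, §2**: `|Core_G(S)| · |T| · |U| ≤ |G|` for a subgroup TPP triple `(S, T, U)` of a
finite group (Fact 3 applied to the sub-triple `(Core_G(S), T, U)`, whose first member is normal).
[cite: Hedtke2011, §2 (proof of the Theorem)] -/
theorem Hedtke2011_coreBound [Finite G] {S T U : Subgroup G} (h : SubgroupTPP S T U) :
    Nat.card S.normalCore * Nat.card T * Nat.card U ≤ Nat.card G :=
  Murthy2026_prop26_2_subgroup (h.mono₁ S.normalCore_le)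

/-- **Hedtke 2011, §2, as printed**: `|S|·|T|·|U| ≤ |S| · |G| / |Core_G(S)|`, in the integral form
`|S||T||U| · |Core_G(S)| ≤ |S| · |G|`. [cite: Hedtke2011, §2 (displayed bound)] -/
theorem Hedtke2011_coreBound' [Finite G] {S T U : Subgroup G} (h : SubgroupTPP S T U) :
    Nat.card S * Nat.card T * Nat.card U * Nat.card S.normalCore ≤ Nat.card S * Nat.card G := by
  calc Nat.card S * Nat.card T * Nat.card U * Nat.card S.normalCore
      = Nat.card S * (Nat.card S.normalCore * Nat.card T * Nat.card U) := by ring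
    _ ≤ Nat.card S * Nat.card G := Nat.mul_le_mul_left _ (Hedtke2011_coreBound h)

end Literature.Computability.AlgebraicComplexity
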